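import Literature.Computability.AlgebraicComplexity.ConstituentStageTriples
import HarnessLib

/-!
# `Y`-compatibility, `Y`-usefulness and `Y`-typicalness one level down, and Claim 6.9
(Alman–Duan–Vassilevska Williams–Xu–Xu–Zhou 2025, §6.3: `S_{t,*,j',*}`, `β̄_{Y,t,*,j',*}`, Def. 6.8,
Claim 6.9, Def. 6.10) — definitions and proofs

Topic `Literature/Computability/AlgebraicComplexity`.  The constituent stage (§6) of Alman–Duan–
Vassilevska Williams–Xu–Xu–Zhou, *More asymmetry yields faster matrix multiplication* (SODA 2025,
arXiv:2404.16349) repeats the `Y`-compatibility zero-outs of §5.3 one level down ("The goal of the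
`Y`-compatibility zero-out step is to ensure each level-1 `Y`-block belongs to a unique block triple"),
with the position classes `S_{t,i',j',k'}` of a level-`(ℓ−1)` block triple refined by the level-`ℓ` term `t`
(`ConstituentStageData.pairClass`) and the classes `S_{t,*,j',*} = {p in the t-th part | J_p = j'}`.  This
file vendors that vocabulary — the `Y`-twin of `ConstituentStageTriples.lean` (VXXZ Defs. 6.9/6.11 for
`Z`) and the level-`(ℓ−1)` counterpart of `YCompatibility.lean` — and PROVES the facts the structure
theorem (`MoreAsymHashedZeroOut.WellFormed`) needs:

* `pairClassY` (`S_{t,*,j',*}`), `boxTriplesY` (the constituent triples `(i',j',k') ≤ (i_t,j_t,k_t)` with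
  middle coordinate `j'`), `card_filter_pairClassY_eq_sum` — for a triple inside the level-`ℓ` blocks,
  `S_{t,*,j',*}` is the disjoint union of the `S_{t,i',j',k'}` over the box; the averaging identity
  `completeSplitOn_pairClassY_mul_card`;
* `betaBarY` — **`β̄_{Y,t,*,j',*}`**, the weighted average over the box with weights
  `α_t(i',j',k') + α_t(i_t−i',j_t−j',k_t−k')` (given as the counts `cnt t` of an `{α_t}`-consistent triple);
* `IsTypicalY₂` (the second item of Def. 6.8 = the zero-out I condition), `IsYCompatibleWith₂`
  (**Def. 6.8**: the classes with `k' = 0`, and typicalness on every `S_{t,*,j',*}`); **Def. 6.10**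
  (`Y`-usefulness) is `IsUsefulFor₂ τ β_Y` of `ConstituentStageTriples.lean`;
* `IsUsefulFor₂.isTypicalY₂`, `IsUsefulFor₂.isYCompatibleWith₂` — **a `Y`-useful block of an
  `{α_t}`-consistent triple inside the level-`ℓ` blocks is `Y`-typical, hence `Y`-compatible**;
* `eq_rev_of_add_eq_two_z`, `yCompatible_fst_of_usefulX₂`, `advxxz2025_claim69` — **Claim 6.9** ("The proof
  is similar to the proof of (cl:global:Y-compatible)" = Claim 5.7), in combinatorial form: for
  complementary level-1 sequences `Î + Ĵ + K̂ = 2⃗`, on the classes with `k' = 0` the `Ĵ`-chunks are `2⃗ −`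
  the `Î`-chunks, so if `Î` is useful for the `X`-data of the triple of their blocks and the `Y`-data follows
  Remark 6.1's convention `β_{Y,t,i',j',0}(L) = β_{X,t,i',j',0}(2⃗ − L)`, then
  `split(Ĵ, S_{t,i',j',0}) = β_{Y,t,i',j',0}` on every occurring class — with typicalness, `Ĵ` is
  `Y`-compatible.

Everything is proved; the definitions are the ones listed; no named facts.

## References

* J. Alman, R. Duan, V. Vassilevska Williams, Y. Xu, Z. Xu, R. Zhou, *More asymmetry yields faster
  matrix multiplication*, SODA 2025, arXiv:2404.16349 (held: `paper:arxiv-2404.16349`, chunks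
  p0023–p0024): §6.3 (`S_{t,i',j',k'}`, `S_{t,*,j',*}`, the zero-outs, Def. 6.8, Claim 6.9, Def. 6.10),
  Remark 6.1, Claim 5.7 (proof). [AlmanDuanVassilevskaWilliamsXuXuZhou2025]
* V. Vassilevska Williams, Y. Xu, Z. Xu, R. Zhou, *New bounds for matrix multiplication: from alpha
  to omega*, SODA 2024, arXiv:2307.07970, §6.3–§6.5 (the `Z`-dimension originals).
  [VassilevskaWilliamsXuXuZhou2024]
-/

noncomputable section

open scoped BigOperators
open Finset

namespace Literature.Computability.AlgebraicComplexity

/-! ## The classes `S_{t,*,j',*}` and the box of constituent triples with middle coordinate `j'` -/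

section Classes

variable {c n s : ℕ} (τ : Fin n → Fin s)

/-- **`S_{t,*,j',*}`**: the half-chunk positions of term `t` with `J_p = j'`. [cite: AlmanDuanVassilevskaWilliamsXuXuZhou2025, §6.3 (S^{(J)}_{t,*,j',*})] -/
def pairClassY (J : Fin (n + n) → ℕ) (t : Fin s) (j : ℕ) : Finset (Fin (n + n)) :=
  univ.filter fun p => halfTermOf τ p = t ∧ J p = j

/-- Membership. [folklore] -/
@[simp] theorem mem_pairClassY {J : Fin (n + n) → ℕ} {t : Fin s} {j : ℕ} {p : Fin (n + n)} :
    p ∈ pairClassY τ J t j ↔ halfTermOf τ p = t ∧ J p = j := by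
  simp [pairClassY]

/-- `S_{t,i',j',k'} ⊆ S_{t,*,j',*}`. [cite: AlmanDuanVassilevskaWilliamsXuXuZhou2025, §6.3] -/
theorem pairClass_subset_pairClassY (I J K : Fin (n + n) → ℕ) (t : Fin s) (i j k : ℕ) :
    pairClass τ I J K t i j k ⊆ pairClassY τ J t j := by
  intro p hp
  rw [mem_pairClass] at hp
  exact (mem_pairClassY τ).2 ⟨hp.1, hp.2.2.1⟩

/-- **The `Y`-box**: the constituent triples `(i',j',k') ≤ (i_t,j_t,k_t)` (componentwise) with middle
coordinate `j'`. [cite: AlmanDuanVassilevskaWilliamsXuXuZhou2025, Def. 6.8 ("(i',j',k') ∈ ℤ³_{≥0} ∩ ([0,i_t]×[0,j_t]×[0,k_t]) with i'+j'+k' = 2^{ℓ−1}")] -/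
def boxTriplesY (c : ℕ) (T : InterfaceTerm (c + c)) (j : ℕ) : Finset (ℕ × ℕ × ℕ) :=
  (constituentTriples c).filter fun ijk => ijk.2.1 = j ∧ ijk.1 ≤ T.i ∧ ijk.2.1 ≤ T.j ∧ ijk.2.2 ≤ T.k

omit τ in
/-- Membership in the `Y`-box. [folklore] -/
theorem mem_boxTriplesY {T : InterfaceTerm (c + c)} {j : ℕ} {ijk : ℕ × ℕ × ℕ} :
    ijk ∈ boxTriplesY c T j ↔ ijk.1 + ijk.2.1 + ijk.2.2 = 2 * c ∧ ijk.2.1 = j ∧ ijk.1 ≤ T.i ∧ ijk.2.1 ≤ T.j ∧ ijk.2.2 ≤ T.k := by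
  rw [boxTriplesY, mem_filter, mem_constituentTriples]

variable (L : Fin s → InterfaceTerm (c + c))

/-- For a level triple inside the level-`ℓ` blocks, the constituent triple at a position of term `t` with
`J_p = j'` lies in the `Y`-box. [cite: AlmanDuanVassilevskaWilliamsXuXuZhou2025, §6.3] -/
theorem triple_mem_boxTriplesY {I J K : Fin (n + n) → ℕ} (h : IsLevelTriple c I J K)
    (hI : ∀ u, I (Fin.castAdd n u) + I (Fin.natAdd n u) = (L (τ u)).i)
    (hJ : ∀ u, J (Fin.castAdd n u) + J (Fin.natAdd n u) = (L (τ u)).j)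
    (hK : ∀ u, K (Fin.castAdd n u) + K (Fin.natAdd n u) = (L (τ u)).k) (p : Fin (n + n)) :
    (I p, J p, K p) ∈ boxTriplesY c (L (halfTermOf τ p)) (J p) := by
  have hb := triple_mem_boxTriples τ L h hI hJ hK p
  rw [mem_boxTriples] at hb
  rw [mem_boxTriplesY]
  exact ⟨hb.1, rfl, hb.2.2⟩

/-- **`S_{t,*,j',*}` decomposes over the `Y`-box**: for a level triple inside the level-`ℓ` blocks and any
predicate `Q` on positions, `#{p ∈ S_{t,*,j',*} | Q p} = ∑_{(i',j',k') ∈ box} #{p ∈ S_{t,i',j',k'} | Q p}`.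
[cite: AlmanDuanVassilevskaWilliamsXuXuZhou2025, §6.3 and Claim 5.12 (proof, the averaging)] -/
theorem card_filter_pairClassY_eq_sum {I J K : Fin (n + n) → ℕ} (h : IsLevelTriple c I J K)
    (hI : ∀ u, I (Fin.castAdd n u) + I (Fin.natAdd n u) = (L (τ u)).i)
    (hJ : ∀ u, J (Fin.castAdd n u) + J (Fin.natAdd n u) = (L (τ u)).j)
    (hK : ∀ u, K (Fin.castAdd n u) + K (Fin.natAdd n u) = (L (τ u)).k)
    (t : Fin s) (j : ℕ) (Q : Fin (n + n) → Prop) [DecidablePred Q] :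
    ((pairClassY τ J t j).filter Q).card =
      ∑ ijk ∈ boxTriplesY c (L t) j, ((pairClass τ I J K t ijk.1 ijk.2.1 ijk.2.2).filter Q).card := by
  rw [card_eq_sum_card_fiberwise (f := fun p => (I p, J p, K p)) (s := (pairClassY τ J t j).filter Q)
    (t := boxTriplesY c (L t) j) ?_]
  · refine sum_congr rfl fun ijk hijk => ?_
    obtain ⟨i, j', k⟩ := ijk
    rw [mem_boxTriplesY] at hijk
    have hj' : j' = j := hijk.2.1
    congr 1
    ext p
    simp only [mem_filter, mem_pairClassY, mem_pairClass, Prod.mk.injEq]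
    constructor
    · rintro ⟨⟨⟨ht, -⟩, hq⟩, h1, h2, h3⟩
      exact ⟨⟨ht, h1, h2, h3⟩, hq⟩
    · rintro ⟨⟨ht, h1, h2, h3⟩, hq⟩
      exact ⟨⟨⟨ht, h2.trans hj'⟩, hq⟩, h1, h2, h3⟩
  · intro p hp
    have hp' := mem_filter.1 hp
    obtain ⟨ht, hj⟩ := (mem_pairClassY τ).1 hp'.1
    show (I p, J p, K p) ∈ boxTriplesY c (L t) j
    rw [← hj, ← ht]
    exact triple_mem_boxTriplesY τ L h hI hJ hK p

/-- **The averaging identity**: `split(Ĵ, S_{t,*,j',*})(σ) · |S_{t,*,j',*}| = ∑_{box} split(Ĵ, S_{t,i',j',k'})(σ) · |S_{t,i',j',k'}|`.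
[cite: AlmanDuanVassilevskaWilliamsXuXuZhou2025, Claim 5.12 (proof), used in §6.5] -/
theorem completeSplitOn_pairClassY_mul_card {I J K : Fin (n + n) → ℕ} (h : IsLevelTriple c I J K)
    (hI : ∀ u, I (Fin.castAdd n u) + I (Fin.natAdd n u) = (L (τ u)).i)
    (hJ : ∀ u, J (Fin.castAdd n u) + J (Fin.natAdd n u) = (L (τ u)).j)
    (hK : ∀ u, K (Fin.castAdd n u) + K (Fin.natAdd n u) = (L (τ u)).k)
    (Jh : Fin (n + n) → Fin c → Fin 3) (t : Fin s) (j : ℕ) (σ : Fin c → Fin 3) :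
    completeSplitOn Jh (pairClassY τ J t j) σ * (pairClassY τ J t j).card =
      ∑ ijk ∈ boxTriplesY c (L t) j, completeSplitOn Jh (pairClass τ I J K t ijk.1 ijk.2.1 ijk.2.2) σ *
        (pairClass τ I J K t ijk.1 ijk.2.1 ijk.2.2).card := by
  rw [completeSplitOn_mul_card, card_filter_pairClassY_eq_sum τ L h hI hJ hK t j (fun p => Jh p = σ)]
  push_cast
  exact sum_congr rfl fun ijk _ => (completeSplitOn_mul_card Jh _ σ).symm

/-- `|S_{t,*,j',*}| = ∑_{box} |S_{t,i',j',k'}|`. [cite: AlmanDuanVassilevskaWilliamsXuXuZhou2025, §6.3] -/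
theorem card_pairClassY_eq_sum {I J K : Fin (n + n) → ℕ} (h : IsLevelTriple c I J K)
    (hI : ∀ u, I (Fin.castAdd n u) + I (Fin.natAdd n u) = (L (τ u)).i)
    (hJ : ∀ u, J (Fin.castAdd n u) + J (Fin.natAdd n u) = (L (τ u)).j)
    (hK : ∀ u, K (Fin.castAdd n u) + K (Fin.natAdd n u) = (L (τ u)).k) (t : Fin s) (j : ℕ) :
    (pairClassY τ J t j).card = ∑ ijk ∈ boxTriplesY c (L t) j, (pairClass τ I J K t ijk.1 ijk.2.1 ijk.2.2).card := by
  have := card_filter_pairClassY_eq_sum τ L h hI hJ hK t j (fun _ => True)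
  simpa using this

end Classes

/-! ## `β̄_{Y,t,*,j',*}`, `Y`-typicalness, `Y`-compatibility, `Y`-usefulness -/

section Compatibility

variable {c n s : ℕ} (τ : Fin n → Fin s)

/-- **`β̄_{Y,t,*,j',*}`** (§6.3): the weighted average, over the `Y`-box, of the `β_{Y,t,i',j',k'}` with weights
`α_t(i',j',k') + α_t(i_t−i',j_t−j',k_t−k')` — here with the weights given as real numbers `w (i',j',k')`
(for an `{α_t}`-consistent triple: `w = cnt t = #left(t,·)`, proportional to `α_t`). [cite: AlmanDuanVassilevskaWilliamsXuXuZhou2025, §6.3 (β̄_{Y,t,*,j',*}) and §6 (notation f̄)] -/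
def betaBarY (c : ℕ) (T : InterfaceTerm (c + c)) (w : ℕ × ℕ × ℕ → ℝ) (βY : ℕ × ℕ × ℕ → (Fin c → Fin 3) → ℝ) (j : ℕ) :
    (Fin c → Fin 3) → ℝ := fun σ =>
  (∑ ijk ∈ boxTriplesY c T j, (w ijk + w (T.i - ijk.1, T.j - ijk.2.1, T.k - ijk.2.2)) * βY ijk σ) /
    ∑ ijk ∈ boxTriplesY c T j, (w ijk + w (T.i - ijk.1, T.j - ijk.2.1, T.k - ijk.2.2))

/-- **`Y`-typicalness one level down** (the second item of Def. 6.8, the condition of the `Y`-compatibility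
zero-out I): `split(Ĵ, S_{t,*,j',*}) = β̄_{Y,t,*,j',*}` for every `t` and every (occurring) `j'`.
[cite: AlmanDuanVassilevskaWilliamsXuXuZhou2025, Def. 6.8 (second item) and §6.3.1] -/
def IsTypicalY₂ (L : Fin s → InterfaceTerm (c + c)) (w : Fin s → ℕ × ℕ × ℕ → ℝ) (βY : Fin s → ℕ × ℕ × ℕ → (Fin c → Fin 3) → ℝ)
    (J : Fin (n + n) → ℕ) (Jh : Fin (n + n) → Fin c → Fin 3) : Prop :=
  ∀ t j, (pairClassY τ J t j).Nonempty → completeSplitOn Jh (pairClassY τ J t j) = betaBarY c (L t) (w t) (βY t) j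

/-- **Def. 6.8 (`Y`-compatibility)** of `Y_Ĵ ∈ Y_J` with the triple `(I,J,K)`: (1) `split(Ĵ, S_{t,i',j',k'}) =
β_{Y,t,i',j',k'}` on the occurring classes with `k' = 0`; (2) `Y`-typicalness.
[cite: AlmanDuanVassilevskaWilliamsXuXuZhou2025, Def. 6.8] -/
def IsYCompatibleWith₂ (L : Fin s → InterfaceTerm (c + c)) (w : Fin s → ℕ × ℕ × ℕ → ℝ) (βY : Fin s → ℕ × ℕ × ℕ → (Fin c → Fin 3) → ℝ)
    (I J K : Fin (n + n) → ℕ) (Jh : Fin (n + n) → Fin c → Fin 3) : Prop :=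
  (∀ t i j k, k = 0 → (pairClass τ I J K t i j k).Nonempty →
      completeSplitOn Jh (pairClass τ I J K t i j k) = βY t (i, j, k)) ∧
    IsTypicalY₂ τ L w βY J Jh

/-- **Def. 6.10 (`Y`-usefulness)** is `IsUsefulFor₂ τ β_Y I J K Ĵ`: `split(Ĵ, S_{t,i',j',k'}) = β_{Y,t,i',j',k'}`
for every `t` and every (occurring) `(i',j',k')`. [cite: AlmanDuanVassilevskaWilliamsXuXuZhou2025, Def. 6.10] -/
theorem isUsefulFor₂_iff_y (βY : Fin s → ℕ × ℕ × ℕ → (Fin c → Fin 3) → ℝ) (I J K : Fin (n + n) → ℕ) (Jh : Fin (n + n) → Fin c → Fin 3) :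
    IsUsefulFor₂ τ βY I J K Jh ↔
      ∀ t i j k, (pairClass τ I J K t i j k).Nonempty → completeSplitOn Jh (pairClass τ I J K t i j k) = βY t (i, j, k) :=
  Iff.rfl

variable (L : Fin s → InterfaceTerm (c + c))

/-- **A `Y`-useful block of an `{α_t}`-consistent triple inside the level-`ℓ` blocks is `Y`-typical**
(averaging: `split(Ĵ, S_{t,*,j',*}) |S_{t,*,j',*}| = ∑_box β_{Y,t,i',j',k'} |S_{t,i',j',k'}|` and
`|S_{t,i',j',k'}| = cnt(i',j',k') + cnt(i_t−i',j_t−j',k_t−k')`). [cite: AlmanDuanVassilevskaWilliamsXuXuZhou2025, Claim 5.12 (proof, "condition (3) is strictly stronger than condition (1)"), §6.5] -/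
theorem IsUsefulFor₂.isTypicalY₂ {βY : Fin s → ℕ × ℕ × ℕ → (Fin c → Fin 3) → ℝ} {cnt : Fin s → ℕ × ℕ × ℕ → ℕ}
    {I J K : Fin (n + n) → Fin (2 * c + 1)} (h : IsLevelTriple c (seqVal I) (seqVal J) (seqVal K))
    (hI : InsideX τ L I) (hJ : InsideY τ L J) (hK : InsideZ τ L K) (hcnt : IsAlphaTConsistent τ cnt (seqVal I) (seqVal J) (seqVal K))
    {Jh : Fin (n + n) → Fin c → Fin 3} (hu : IsUsefulFor₂ τ βY (seqVal I) (seqVal J) (seqVal K) Jh) :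
    IsTypicalY₂ τ L (fun t ijk => (cnt t ijk : ℝ)) βY (seqVal J) Jh := by
  intro t j hne
  funext σ
  have hsize : ∀ ijk ∈ boxTriplesY c (L t) j,
      ((pairClass τ (seqVal I) (seqVal J) (seqVal K) t ijk.1 ijk.2.1 ijk.2.2).card : ℝ) =
        (cnt t ijk : ℝ) + cnt t ((L t).i - ijk.1, (L t).j - ijk.2.1, (L t).k - ijk.2.2) := by
    intro ijk hijk
    rw [mem_boxTriplesY] at hijk
    rw [card_pairClass_eq τ L hI hJ hK t hijk.2.2.1 hijk.2.2.2.1 hijk.2.2.2.2, ← hcnt t ijk, ← hcnt t _]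
    push_cast
    rfl
  have havg := completeSplitOn_pairClassY_mul_card τ L h hI hJ hK Jh t j σ
  have hcard := card_pairClassY_eq_sum τ L h hI hJ hK t j
  have hterm : ∀ ijk ∈ boxTriplesY c (L t) j,
      completeSplitOn Jh (pairClass τ (seqVal I) (seqVal J) (seqVal K) t ijk.1 ijk.2.1 ijk.2.2) σ *
          (pairClass τ (seqVal I) (seqVal J) (seqVal K) t ijk.1 ijk.2.1 ijk.2.2).card =
        ((cnt t ijk : ℝ) + cnt t ((L t).i - ijk.1, (L t).j - ijk.2.1, (L t).k - ijk.2.2)) * βY t ijk σ := by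
    intro ijk hijk
    rcases (pairClass τ (seqVal I) (seqVal J) (seqVal K) t ijk.1 ijk.2.1 ijk.2.2).eq_empty_or_nonempty with he | hne'
    · have h0 : ((cnt t ijk : ℝ) + cnt t ((L t).i - ijk.1, (L t).j - ijk.2.1, (L t).k - ijk.2.2)) = 0 := by
        rw [← hsize ijk hijk, he, card_empty, Nat.cast_zero]
      rw [he, card_empty, Nat.cast_zero, mul_zero, h0, zero_mul]
    · rw [hu t _ _ _ hne', hsize ijk hijk, mul_comm]
  rw [sum_congr rfl hterm] at havg
  have hpos : (0 : ℝ) < (pairClassY τ (seqVal J) t j).card := by exact_mod_cast hne.card_pos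
  have hW : ((pairClassY τ (seqVal J) t j).card : ℝ) =
      ∑ ijk ∈ boxTriplesY c (L t) j, ((cnt t ijk : ℝ) + cnt t ((L t).i - ijk.1, (L t).j - ijk.2.1, (L t).k - ijk.2.2)) := by
    rw [hcard]; push_cast
    exact sum_congr rfl hsize
  simp only [betaBarY]
  rw [eq_div_iff (by rw [← hW]; exact hpos.ne'), ← hW]
  exact havg

/-- Hence **a `Y`-useful block of an `{α_t}`-consistent triple inside the level-`ℓ` blocks is `Y`-compatible
with it.** [cite: AlmanDuanVassilevskaWilliamsXuXuZhou2025, §6.3.3 (Def. 6.10) and Claim 5.12 (proof)] -/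
theorem IsUsefulFor₂.isYCompatibleWith₂ {βY : Fin s → ℕ × ℕ × ℕ → (Fin c → Fin 3) → ℝ} {cnt : Fin s → ℕ × ℕ × ℕ → ℕ}
    {I J K : Fin (n + n) → Fin (2 * c + 1)} (h : IsLevelTriple c (seqVal I) (seqVal J) (seqVal K))
    (hI : InsideX τ L I) (hJ : InsideY τ L J) (hK : InsideZ τ L K) (hcnt : IsAlphaTConsistent τ cnt (seqVal I) (seqVal J) (seqVal K))
    {Jh : Fin (n + n) → Fin c → Fin 3} (hu : IsUsefulFor₂ τ βY (seqVal I) (seqVal J) (seqVal K) Jh) :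
    IsYCompatibleWith₂ τ L (fun t ijk => (cnt t ijk : ℝ)) βY (seqVal I) (seqVal J) (seqVal K) Jh :=
  ⟨fun t i j k _ hne => hu t i j k hne, hu.isTypicalY₂ τ L h hI hJ hK hcnt⟩

/-- A `Y`-compatible block is `Y`-typical. [cite: AlmanDuanVassilevskaWilliamsXuXuZhou2025, Def. 6.8 (item 2)] -/
theorem IsYCompatibleWith₂.isTypicalY₂ {w : Fin s → ℕ × ℕ × ℕ → ℝ} {βY : Fin s → ℕ × ℕ × ℕ → (Fin c → Fin 3) → ℝ}
    {I J K : Fin (n + n) → ℕ} {Jh : Fin (n + n) → Fin c → Fin 3} (hc : IsYCompatibleWith₂ τ L w βY I J K Jh) :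
    IsTypicalY₂ τ L w βY J Jh :=
  hc.2

end Compatibility

/-! ## Claim 6.9: `Y`-compatibility of `Ĵ` with the triple of `Î` -/

section Claim69

variable {c n s : ℕ} (τ : Fin n → Fin s)

omit τ in
/-- On a chunk whose `Z`-shape is `0⃗`, complementary shapes satisfy `Ĵ = 2⃗ − Î` ("since `k' = 0`, …
`(K̂_…) = 0⃗` … so `(Ĵ_…) = 2⃗ − (Î_…)`"). [cite: AlmanDuanVassilevskaWilliamsXuXuZhou2025, Claim 5.7 (proof), Claim 6.9] -/
theorem eq_rev_of_add_eq_two_z {Ih Jh Kh : Fin (n + n) → Fin c → Fin 3} (hsum : ∀ p r, (Ih p r : ℕ) + Jh p r + Kh p r = 2)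
    {p : Fin (n + n)} (hp : chunkLevels Kh p = 0) : Jh p = fun r => (Ih p r).rev := by
  funext r
  have h0 : Kh p r = 0 := pattern_eq_zero_of_patternLevel_eq_zero (by simpa using hp) r
  have h2 := hsum p r
  rw [h0] at h2
  apply Fin.ext
  rw [Fin.val_rev]
  have := (Ih p r).isLt
  have := (Jh p r).isLt
  simp only [Fin.val_zero, add_zero] at h2
  omega

/-- **Claim 6.9, item (1) of `Y`-compatibility**: for complementary level-1 sequences `Î + Ĵ + K̂ = 2⃗` on the
half-chunk positions, if `Î` is useful for the `X`-data of the triple `(I,J,K)` of their blocks (the `X`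
zero-out of §6.3) and the `Y`-data follows Remark 6.1's convention `β_{Y,t,i',j',0}(L) = β_{X,t,i',j',0}(2⃗ − L)`,
then `split(Ĵ, S_{t,i',j',k'}) = β_{Y,t,i',j',k'}` on every occurring class with `k' = 0`.
[cite: AlmanDuanVassilevskaWilliamsXuXuZhou2025, Claim 6.9 (via the proof of Claim 5.7) and Remark 6.1] -/
theorem yCompatible_fst_of_usefulX₂ {βX βY : Fin s → ℕ × ℕ × ℕ → (Fin c → Fin 3) → ℝ}
    (hYX : ∀ t i j σ, βY t (i, j, 0) σ = βX t (i, j, 0) (fun r => (σ r).rev))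
    {Ih Jh Kh : Fin (n + n) → Fin c → Fin 3} (hsum : ∀ p r, (Ih p r : ℕ) + Jh p r + Kh p r = 2)
    (hx : IsUsefulFor₂ τ βX (chunkLevels Ih) (chunkLevels Jh) (chunkLevels Kh) Ih)
    (t : Fin s) (i j k : ℕ) (hk : k = 0)
    (hne : (pairClass τ (chunkLevels Ih) (chunkLevels Jh) (chunkLevels Kh) t i j k).Nonempty) :
    completeSplitOn Jh (pairClass τ (chunkLevels Ih) (chunkLevels Jh) (chunkLevels Kh) t i j k) = βY t (i, j, k) := by
  subst hk
  funext σ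
  rw [completeSplitOn_rev_on (I := Ih) (fun p hp => eq_rev_of_add_eq_two_z hsum ((mem_pairClass τ).1 hp).2.2.2) σ,
    hx t i j 0 hne, hYX]

/-- **ADVXXZ Claim 6.9**: "In `𝒯_YComp`, for every level-1 block triple `X_Î Y_Ĵ Z_K̂` and the … block triple
`X_I Y_J Z_K` that contains it, `Y_Ĵ` is compatible with `X_I Y_J Z_K`" — the remaining `X_Î` being useful
(the `X` zero-out of §6.3) and the remaining `Y_Ĵ` typical (zero-out I), under Remark 6.1's convention on
`β_Y`. [cite: AlmanDuanVassilevskaWilliamsXuXuZhou2025, Claim 6.9] -/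
theorem advxxz2025_claim69 (L : Fin s → InterfaceTerm (c + c)) {w : Fin s → ℕ × ℕ × ℕ → ℝ}
    {βX βY : Fin s → ℕ × ℕ × ℕ → (Fin c → Fin 3) → ℝ}
    (hYX : ∀ t i j σ, βY t (i, j, 0) σ = βX t (i, j, 0) (fun r => (σ r).rev))
    {Ih Jh Kh : Fin (n + n) → Fin c → Fin 3} (hsum : ∀ p r, (Ih p r : ℕ) + Jh p r + Kh p r = 2)
    (hx : IsUsefulFor₂ τ βX (chunkLevels Ih) (chunkLevels Jh) (chunkLevels Kh) Ih)
    (hy : IsTypicalY₂ τ L w βY (chunkLevels Jh) Jh) :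
    IsYCompatibleWith₂ τ L w βY (chunkLevels Ih) (chunkLevels Jh) (chunkLevels Kh) Jh :=
  ⟨fun t i j k hk hne => yCompatible_fst_of_usefulX₂ τ hYX hsum hx t i j k hk hne, hy⟩

end Claim69

end Literature.Computability.AlgebraicComplexity
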